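import Literature.AnabelianGeometry.AbsoluteAnabelian.MonoidKummerTransport
import Literature.AnabelianGeometry.AbsoluteAnabelian.UnitKummerModelProofs

/-!
# [AbsTopIII] Prop 3.3 (i): transport of unit Kummer theories along isomorphisms of pairs; the unit
# Kummer theory of an arbitrary MLF-Galois `TCG`- or `TLG`-pair, with Kummer-faithfulness for compact `Π`

S. Mochizuki, *Topics in absolute anabelian geometry III*, §3, Prop. 3.3 (i) p. 73 (bib key
`MochizukiAbsTopIII2015`; lit key `paper:url-5493eb38cbb7`): for `T ∈ {TLG, TCG}` and an MLF-Galois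
`T`-pair `(Π ↷ M)`, "functorial algorithms for constructing the Kummer maps
`M^H → H¹(H, μ_Ẑ(M))`, `M → lim_J H¹(J, μ_Ẑ(M))`", where "the natural isomorphism `μ_Ẑ(M) ⥲ μ_Ẑ(G)` is
only determined up to a `{±1}`- (respectively, `Ẑ^×`-) multiple".

`UnitKummerModel.lean` / `UnitKummerModelProofs.lean` (seat abc-iut-L4-t2 gen 2) BUILT
`UnitKummerTheory .TCG (Π_k ↷ 𝒪_k̄^×)` / `.TLG (Π_k ↷ k̄^×)` for the MODEL and proved their Kummer maps
injective (for open `ε_k(H)`, in particular for compact `Π_k`).  This file (seat abc-iut-L4-t2; cone row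
AbsTopIII:Prop3.3(i)) carries them to EVERY MLF-Galois `TCG`- or `TLG`-pair:

* `UnitKummerTheory.transport e` — transport along an isomorphism of pairs `e : (Π ↷ M) ⥲ (Π' ↷ M')`:
  cohomology along `e_Π` (`ContCohomologyData.transport`), the CLASS of cyclotome identifications
  precomposed with `μ_Ẑ(M') ⥲ μ_Ẑ(M)` (its `{±1}`- resp. `Ẑ^×`-torsor clauses PROVED to transport: the
  comparison automorphisms are conjugated by `μ_Ẑ(e_M)`, which fixes `id` and inversion), Kummer maps
  `κ_{H'}(m') := κ_{e_Π⁻¹ H'}(e_M⁻¹ m')`;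
* `UnitKummerTheory.transport_kummer_injective`;
* **`exists_unitKummerTheory_TCG_injective`**, **`exists_unitKummerTheory_TLG_injective`** — every
  MLF-Galois `TCG`- or `TLG`-pair with COMPACT `Π` carries a unit Kummer theory whose Kummer maps are
  INJECTIVE at every open `H ⊆ Π`.  (Mere inhabitation of `UnitKummerTheory` is vacuous — finding
  F-w5d049-1: the structure has no laws on its Kummer fields — so injectivity is the content recorded.)

HONEST FRAMING: existence by transport from the model; OUR kernel constructions; nothing here bears on
[IUTchIII] Cor. 3.12; typed ≠ proved downstream.
-/

noncomputable section

universe u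

namespace Literature.AnabelianGeometry.AbsoluteAnabelian

open Literature.AnabelianGeometry.EtaleTheta (cyclotome)

namespace UnitKummerTheory

variable {T : PairType} {P Q : GaloisMonoidPair.{u}}

/-- Conjugation of an automorphism of `μ_Ẑ(M)` by `μ_Ẑ(M) ⥲ μ_Ẑ(M')`: `c⁻¹ ∘ u ∘ c` read on `μ_Ẑ(M')`
(`c : μ_Ẑ(M') ⥲ μ_Ẑ(M)`). [cite: MochizukiAbsTopIII2015, Proposition 3.3 (i) p.73] -/
def conjAut (c : cyclotome Q.M ≃* cyclotome P.M) (u : cyclotome P.M ≃* cyclotome P.M) :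
    cyclotome Q.M ≃* cyclotome Q.M :=
  (c.trans u).trans c.symm

/-- Conjugation fixes the identity. [cite: MochizukiAbsTopIII2015, Proposition 3.3 (i) p.73] -/
theorem conjAut_refl (c : cyclotome Q.M ≃* cyclotome P.M) :
    conjAut c (MulEquiv.refl _) = MulEquiv.refl _ :=
  MulEquiv.ext fun ζ => by simp [conjAut]

/-- Conjugation fixes inversion (`c` is a group isomorphism). [cite: MochizukiAbsTopIII2015, Proposition 3.3 (i) p.73] -/
theorem conjAut_inv (c : cyclotome Q.M ≃* cyclotome P.M) :
    conjAut c (MulEquiv.inv (cyclotome P.M)) = MulEquiv.inv (cyclotome Q.M) :=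
  MulEquiv.ext fun ζ => by simp [conjAut]

/-- Conjugation back: `c ∘ (conjAut c u) = u ∘ c` pointwise. [cite: MochizukiAbsTopIII2015, Proposition 3.3 (i) p.73] -/
theorem apply_conjAut (c : cyclotome Q.M ≃* cyclotome P.M) (u : cyclotome P.M ≃* cyclotome P.M)
    (ζ : cyclotome Q.M) : c (conjAut c u ζ) = u (c ζ) := by
  simp [conjAut]

/-- Inverse conjugation: `conjAut c (conjAut c.symm u') = u'`. [cite: MochizukiAbsTopIII2015, Proposition 3.3 (i) p.73] -/
theorem conjAut_conjAut_symm (c : cyclotome Q.M ≃* cyclotome P.M) (u' : cyclotome Q.M ≃* cyclotome Q.M) :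
    conjAut c (conjAut c.symm u') = u' :=
  MulEquiv.ext fun ζ => by simp [conjAut]

/-- The `TLG` side condition "`u` is `id` or inversion" is preserved by conjugation.
[cite: MochizukiAbsTopIII2015, Proposition 3.3 (i) p.73] -/
theorem tlgCondition_conjAut (c : cyclotome Q.M ≃* cyclotome P.M) {u : cyclotome P.M ≃* cyclotome P.M}
    (hu : T = .TLG → (u = MulEquiv.refl _ ∨ u = MulEquiv.inv (cyclotome P.M))) :
    T = .TLG → (conjAut c u = MulEquiv.refl _ ∨ conjAut c u = MulEquiv.inv (cyclotome Q.M)) := by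
  intro hT
  rcases hu hT with rfl | rfl
  · exact Or.inl (conjAut_refl c)
  · exact Or.inr (conjAut_inv c)

/-- **Transport of a unit Kummer theory along an isomorphism of pairs** `e : (Π ↷ M) ⥲ (Π' ↷ M')`.
[cite: MochizukiAbsTopIII2015, Proposition 3.3 (i) p.73] -/
def transport (U : UnitKummerTheory T P) (e : GaloisMonoidPair.Iso P Q) : UnitKummerTheory T Q where
  coh := U.coh.transport e.isoPi
  muG := U.muG
  cycIsoClass :=
    (fun g => (MonoidKummerTheory.cyclotomeCongr e.isoM.symm).trans g) '' U.cycIsoClass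
  cycIsoClass_nonempty := U.cycIsoClass_nonempty.image _
  cycIsoClass_torsor := by
    rintro _ ⟨g₁, hg₁, rfl⟩ _ ⟨g₂, hg₂, rfl⟩
    obtain ⟨u, hu, hcomp⟩ := U.cycIsoClass_torsor g₁ hg₁ g₂ hg₂
    refine ⟨conjAut (MonoidKummerTheory.cyclotomeCongr e.isoM.symm) u,
      tlgCondition_conjAut _ hu, fun ζ => ?_⟩
    change g₂ (MonoidKummerTheory.cyclotomeCongr e.isoM.symm ζ) =
      g₁ (MonoidKummerTheory.cyclotomeCongr e.isoM.symm (conjAut _ u ζ))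
    rw [apply_conjAut, hcomp]
  cycIsoClass_full := by
    rintro _ ⟨g₁, hg₁, rfl⟩ u' hu'
    set c := MonoidKummerTheory.cyclotomeCongr e.isoM.symm with hc
    have hu : T = .TLG → (conjAut c.symm u' = MulEquiv.refl _ ∨ conjAut c.symm u' = MulEquiv.inv _) :=
      tlgCondition_conjAut c.symm hu'
    obtain ⟨g₂, hg₂, hcomp⟩ := U.cycIsoClass_full g₁ hg₁ (conjAut c.symm u') hu
    refine ⟨c.trans g₂, ⟨g₂, hg₂, rfl⟩, fun ζ => ?_⟩
    change g₂ (c ζ) = g₁ (c (u' ζ))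
    rw [hcomp, ← conjAut_conjAut_symm c u', apply_conjAut, conjAut_conjAut_symm]
  kummer H m := U.kummer (H.comap e.isoPi.toMonoidHom e.isoPi.continuous)
    ⟨e.isoM.symm m.1, fun g => e.smul_symm_eq_of_mem_comap m.2 g⟩
  kummerLim m := Quot.mk _ ⟨Q.stabilizerOpenSubgroup m,
    U.kummer ((Q.stabilizerOpenSubgroup m).comap e.isoPi.toMonoidHom e.isoPi.continuous)
      ⟨e.isoM.symm m, fun g => e.smul_symm_eq_of_mem_comap (fun h => h.2) g⟩⟩

/-- The Kummer map of the transported unit theory at `H' ⊆ Π'`. [cite: MochizukiAbsTopIII2015, Proposition 3.3 (i) p.73] -/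
theorem transport_kummer (U : UnitKummerTheory T P) (e : GaloisMonoidPair.Iso P Q) (H : OpenSubgroup Q.Pi)
    (m : {m : Q.M // ∀ h : H, (h : Q.Pi) • m = m}) :
    (U.transport e).kummer H m = U.kummer (H.comap e.isoPi.toMonoidHom e.isoPi.continuous)
      ⟨e.isoM.symm m.1, fun g => e.smul_symm_eq_of_mem_comap m.2 g⟩ := rfl

/-- **Injectivity of the Kummer map is preserved by transport.** [cite: MochizukiAbsTopIII2015, Proposition 3.3 (i) p.73] -/
theorem transport_kummer_injective (U : UnitKummerTheory T P) (e : GaloisMonoidPair.Iso P Q)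
    (H : OpenSubgroup Q.Pi)
    (h : Function.Injective (U.kummer (H.comap e.isoPi.toMonoidHom e.isoPi.continuous))) :
    Function.Injective ((U.transport e).kummer H) := by
  intro m m' hmm'
  rw [transport_kummer, transport_kummer] at hmm'
  have h1 := congrArg Subtype.val (h hmm')
  exact Subtype.ext (e.isoM.symm.injective h1)

end UnitKummerTheory

/-! ### Prop 3.3 (i) for every MLF-Galois `TCG`- or `TLG`-pair with compact Galois group -/

/-- **Every MLF-Galois `TCG`-pair with compact `Π` carries a Kummer-faithful unit Kummer theory**: there
are model data, an isomorphism `e : (Π_k ↷ 𝒪_k̄^×) ⥲ P` and `U : UnitKummerTheory TCG P` (the model's,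
transported: `H¹(H, Ẑ(1))` of `k̄`, the `Ẑ^×`-torsor of cyclotome identifications, Kummer classes of
invariant units) whose Kummer maps `M^H → H¹(H, μ)` are injective at every open `H ⊆ Π`.
[cite: MochizukiAbsTopIII2015, Proposition 3.3 (i) p.73] -/
theorem exists_unitKummerTheory_TCG_injective (P : GaloisMonoidPair.{0})
    (hP : IsMLFGaloisMonoidPair .TCG P) [CompactSpace P.Pi] :
    ∃ (C : MLFClosure.{0}) (D : ModelMLFGaloisData C.k C.K) (_ : GaloisMonoidPair.Iso D.tcgPair P)
      (U : UnitKummerTheory .TCG P), ∀ H : OpenSubgroup P.Pi, Function.Injective (U.kummer H) := by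
  obtain ⟨C, D, Q₀, hQ₀, ⟨e⟩⟩ := hP.exists_model
  have hQ' : D.tcgPair = Q₀ := Option.some_injective _ (D.monoidPair_TCG.symm.trans hQ₀)
  subst hQ'
  haveI : CompactSpace D.Pi := e.isoPi.toHomeomorph.symm.compactSpace
  exact ⟨C, D, e, (D.unitKummerTheoryTCG C).transport e, fun H =>
    UnitKummerTheory.transport_kummer_injective _ e H (D.tcgKummer_injective_of_compactSpace C _)⟩

/-- **Every MLF-Galois `TLG`-pair with compact `Π` carries a Kummer-faithful unit Kummer theory**
(the model's `UnitKummerTheory TLG (Π_k ↷ k̄^×)` — with its `{±1}`-torsor of cyclotome identifications —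
transported along `e : (Π_k ↷ k̄^×) ⥲ P`). [cite: MochizukiAbsTopIII2015, Proposition 3.3 (i) p.73] -/
theorem exists_unitKummerTheory_TLG_injective (P : GaloisMonoidPair.{0})
    (hP : IsMLFGaloisMonoidPair .TLG P) [CompactSpace P.Pi] :
    ∃ (C : MLFClosure.{0}) (D : ModelMLFGaloisData C.k C.K) (_ : GaloisMonoidPair.Iso D.tlgPair P)
      (U : UnitKummerTheory .TLG P), ∀ H : OpenSubgroup P.Pi, Function.Injective (U.kummer H) := by
  obtain ⟨C, D, Q₀, hQ₀, ⟨e⟩⟩ := hP.exists_model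
  have hQ' : D.tlgPair = Q₀ := Option.some_injective _ (D.monoidPair_TLG.symm.trans hQ₀)
  subst hQ'
  haveI : CompactSpace D.Pi := e.isoPi.toHomeomorph.symm.compactSpace
  exact ⟨C, D, e, (D.unitKummerTheoryTLG C).transport e, fun H =>
    UnitKummerTheory.transport_kummer_injective _ e H (D.tlgKummer_injective_of_compactSpace C _)⟩

end Literature.AnabelianGeometry.AbsoluteAnabelian

end
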